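import Literature.NumberTheory.Automorphic.WhittakerBiEquivariantSupport
import Literature.NumberTheory.Automorphic.CongruenceTwistedAverage
import HarnessLib

/-!
# The spread level group `d H⁰ d⁻¹` of a finite place and its character

Topic `NumberTheory/Automorphic`; namespace `Literature.NumberTheory.Automorphic.WhittakerSupport`.
Local algebra over a discretely valued field `F` for the construction of the test vector in the
proof of the named fact `JacquetShalika1981_partialPairL_pole_of_eq_conj` in every rank
(Arthur–Clozel (1989), Ch. 3 (2.3); Jacquet–Shalika (1981), §4, (5.1)): the compact open subgroup
of `GL_N(F)` under which the Whittaker function of the test vector is isotypic, so that the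
hypotheses `WhittakerSupport.IsSpreadWhittaker` of the support theorem hold.

* `IsUpperModLevel M g`: `g` is integral and `g - 1` is strictly upper triangular modulo `𝔭^M`
  (lower and diagonal entries of `g - 1` of valuation `≤ exp(-M)`); `upperModLevel N M`, the
  subgroup `H⁰ = {g : g, g⁻¹ upper mod 𝔭^M}` ("`N(𝒪) K(𝔭^M)`"); it contains the congruence subgroup
  `K(𝔭^M)` and the integral column matrices `1 + b ⊗ e_j`.
* `exists_unipotent_mul_lower`: **UL factorisation in `H⁰`** (`M ≥ 1`): for `g ∈ H⁰` there is an
  integral upper unitriangular `n` with `n g` lower triangular (column elimination from the right,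
  the pivots `g_dd ≡ 1` being units).
* `diagConj`: conjugation by a diagonal matrix (the super-diagonal sum `Σ g_{i,i+1}` of a matrix is
  the tree's `sdiagMat` of `CongruenceTwistedAverage`); `addChar_sdiagMat_diagConj_mul`:
  **`h ↦ ψ(Σ h_{i,i+1})` is multiplicative on
  `d H⁰ d⁻¹`**, `d = diag(t)`, as soon as `ψ(t_i t_{i+1}⁻¹ 𝔭^M) = 1`.
* `spreadLevelGroup t M = d H⁰ d⁻¹` and the memberships of the unipotents `u` with `d⁻¹ u d`
  integral and of the `κ` with `d⁻¹ κ^{±1} d ≡ 1 (mod 𝔭^M)` (the two families of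
  `IsSpreadWhittaker`), the value of the character on them, the conjugation estimate
  `h⁻¹ K(𝔭^b) h ⊆ K(𝔭^b R²)` for `h ∈ d H⁰ d⁻¹`, and the factorisation `h = u b`, `u ∈ N(F)`,
  `b ∈ K(𝔭^e)`, `ψ(Σ h_{i,i+1}) = ψ_N(u)` when the ratios `t_i/t_j`, `j < i`, are `≤ exp(-e)`.

All statements are elementary matrix algebra over a valued field. [folklore]

## References

* H. Jacquet, I. I. Piatetski-Shapiro, J. Shalika, *Conducteur des représentations du groupe
  linéaire*, Math. Ann. 256 (1981), §5.
* H. Jacquet, J. A. Shalika, *On Euler products and the classification of automorphic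
  representations I*, Amer. J. Math. 103 (1981), §4–§5 [JacquetShalikaAJM1981].
-/

noncomputable section

open Matrix WithZero
open scoped MatrixGroups

namespace Literature.NumberTheory.Automorphic

namespace WhittakerSupport

variable {F : Type*} [Field F] {N : ℕ}

/-! ### Diagonal conjugation (super-diagonal sums are `sdiagMat`) -/

section Superdiag

/-- Conjugation by the diagonal matrix `d = diag(t)`: `d X d⁻¹`. [folklore] -/
def diagConj (t : Fin N → Fˣ) (X : Matrix (Fin N) (Fin N) F) : Matrix (Fin N) (Fin N) F :=
  Matrix.diagonal (fun i => (t i : F)) * X * Matrix.diagonal (fun i => (((t i)⁻¹ : Fˣ) : F))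

/-- Entries of `d X d⁻¹`: `t_i X_{ij} t_j⁻¹`. [folklore] -/
theorem diagConj_apply (t : Fin N → Fˣ) (X : Matrix (Fin N) (Fin N) F) (i j : Fin N) :
    diagConj t X i j = (t i : F) * X i j * ((t j : F)⁻¹) := by
  rw [diagConj, Matrix.mul_diagonal, Matrix.diagonal_mul, Units.val_inv_eq_inv_val]

/-- Entries of `d⁻¹ X d`: `t_i⁻¹ X_{ij} t_j`. [folklore] -/
theorem diagConj_inv_apply (t : Fin N → Fˣ) (X : Matrix (Fin N) (Fin N) F) (i j : Fin N) :
    diagConj t⁻¹ X i j = ((t i : F))⁻¹ * X i j * (t j : F) := by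
  rw [diagConj_apply, Pi.inv_apply, Pi.inv_apply, Units.val_inv_eq_inv_val, Units.val_inv_eq_inv_val, inv_inv]

/-- `d (X Y) d⁻¹ = (d X d⁻¹)(d Y d⁻¹)`. [folklore] -/
theorem diagConj_mul (t : Fin N → Fˣ) (X Y : Matrix (Fin N) (Fin N) F) :
    diagConj t (X * Y) = diagConj t X * diagConj t Y := by
  unfold diagConj
  have h : Matrix.diagonal (fun i => (((t i)⁻¹ : Fˣ) : F)) * Matrix.diagonal (fun i => (t i : F)) = 1 := by
    rw [Matrix.diagonal_mul_diagonal, ← Matrix.diagonal_one]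
    congr 1
    funext i
    rw [Units.inv_mul]
  rw [Matrix.mul_assoc (Matrix.diagonal _ * X), ← Matrix.mul_assoc (Matrix.diagonal fun i => (((t i)⁻¹ : Fˣ) : F)),
    ← Matrix.mul_assoc (Matrix.diagonal fun i => (((t i)⁻¹ : Fˣ) : F)), h, Matrix.one_mul,
    Matrix.mul_assoc, Matrix.mul_assoc, Matrix.mul_assoc]

/-- `d 1 d⁻¹ = 1`. [folklore] -/
theorem diagConj_one (t : Fin N → Fˣ) : diagConj t (1 : Matrix (Fin N) (Fin N) F) = 1 := by
  ext i j
  rw [diagConj_apply, Matrix.one_apply]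
  split_ifs with h
  · subst h
    rw [mul_one, mul_inv_cancel₀ (t i).ne_zero]
  · rw [mul_zero, zero_mul]

/-- `diagConj` is additive. [folklore] -/
theorem diagConj_add (t : Fin N → Fˣ) (X Y : Matrix (Fin N) (Fin N) F) :
    diagConj t (X + Y) = diagConj t X + diagConj t Y := by
  unfold diagConj
  rw [Matrix.mul_add, Matrix.add_mul]

/-- `diagConj` is subtractive. [folklore] -/
theorem diagConj_sub (t : Fin N → Fˣ) (X Y : Matrix (Fin N) (Fin N) F) :
    diagConj t (X - Y) = diagConj t X - diagConj t Y := by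
  unfold diagConj
  rw [Matrix.mul_sub, Matrix.sub_mul]

/-- The matrix of `diag(t) g diag(t)⁻¹` is `diagConj t g`. [folklore] -/
theorem coe_glDiagonal_conj (t : Fin N → Fˣ) (g : GL (Fin N) F) :
    ((glDiagonal N F t * g * (glDiagonal N F t)⁻¹ : GL (Fin N) F) : Matrix (Fin N) (Fin N) F) =
      diagConj t g := by
  rw [Units.val_mul, Units.val_mul, ← map_inv, coe_glDiagonal, coe_glDiagonal]
  rfl

/-- The matrix of `diag(t)⁻¹ g diag(t)` is `diagConj t⁻¹ g`. [folklore] -/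
theorem coe_glDiagonal_inv_conj (t : Fin N → Fˣ) (g : GL (Fin N) F) :
    (((glDiagonal N F t)⁻¹ * g * glDiagonal N F t : GL (Fin N) F) : Matrix (Fin N) (Fin N) F) =
      diagConj t⁻¹ g := by
  have h := coe_glDiagonal_conj t⁻¹ g
  rwa [map_inv, inv_inv] at h

/-- `g h = g + h - 1 + (g - 1)(h - 1)` in any ring. [folklore] -/
theorem mul_eq_add_add_sub_one_mul (g h : Matrix (Fin N) (Fin N) F) :
    g * h = g + h - 1 + (g - 1) * (h - 1) := by
  rw [sub_mul, mul_sub, mul_sub, one_mul, mul_one, one_mul]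
  abel

/-- `ψ` of a finite sum all of whose terms are killed by `ψ` is `1`. [folklore] -/
theorem addChar_sum_eq_one (ψ : AddChar F Circle) {ι : Type*} (s : Finset ι) {f : ι → F}
    (hf : ∀ i ∈ s, ψ (f i) = 1) : ψ (∑ i ∈ s, f i) = 1 := by
  refine Finset.sum_induction f (fun x => ψ x = 1) (fun a b ha hb => ?_) (AddChar.map_zero_eq_one ψ) hf
  rw [AddChar.map_add_eq_mul, ha, hb, one_mul]

end Superdiag

/-! ### Inverses of integral unipotent matrices are integral -/

section Valued

variable [Valued F ℤᵐ⁰]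

local notation "𝓋" => (Valued.v : Valuation F ℤᵐ⁰)

/-- **The inverse of an integral upper unitriangular matrix is integral** (`(u⁻¹)_{ij}` is
determined by the `(u⁻¹)_{ik}`, `i ≤ k < j`, through `Σ_k (u⁻¹)_{ik} u_{kj} = δ_{ij}`).
[folklore] -/
theorem valuation_inv_le_one_of_mem_upperUnitriangular {u : GL (Fin N) F}
    (hu : u ∈ upperUnitriangular (Fin N) F)
    (hint : ∀ i j, 𝓋 ((u : Matrix (Fin N) (Fin N) F) i j) ≤ 1) :
    ∀ i j, 𝓋 (((u⁻¹ : GL (Fin N) F) : Matrix (Fin N) (Fin N) F) i j) ≤ 1 := by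
  have hu' : u⁻¹ ∈ upperUnitriangular (Fin N) F := inv_mem hu
  rw [mem_upperUnitriangular_iff] at hu hu'
  set w : Matrix (Fin N) (Fin N) F := ((u⁻¹ : GL (Fin N) F) : Matrix (Fin N) (Fin N) F) with hw
  -- `w_{ij} = δ_{ij} - Σ_{k ≠ j} w_{ik} u_{kj}`
  have hrec : ∀ i j, w i j = (if i = j then 1 else 0) -
      ∑ k ∈ Finset.univ.erase j, w i k * (u : Matrix (Fin N) (Fin N) F) k j := by
    intro i j
    have h1 : (w * (u : Matrix (Fin N) (Fin N) F)) i j = if i = j then 1 else 0 := by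
      rw [hw, ← Units.val_mul, inv_mul_cancel, Units.val_one, Matrix.one_apply]
    rw [Matrix.mul_apply, ← Finset.add_sum_erase _ _ (Finset.mem_univ j), hu.2 j, mul_one] at h1
    rw [← h1, add_sub_cancel_right]
  -- induction on the gap `j - i`
  suffices h : ∀ m : ℕ, ∀ i j : Fin N, (j : ℕ) - i ≤ m → 𝓋 (w i j) ≤ 1 from
    fun i j => h _ i j le_rfl
  intro m
  induction m with
  | zero =>
    intro i j hij
    by_cases h : j < i
    · rw [hu'.1 h, Valuation.map_zero]
      exact zero_le
    · have hji : i = j := le_antisymm (not_lt.1 h) (Fin.le_def.2 (by omega))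
      subst hji
      rw [hu'.2 i, Valuation.map_one]
  | succ m ih =>
    intro i j hij
    rw [hrec i j]
    refine (Valuation.map_sub _ _ _).trans (max_le ?_ ?_)
    · split_ifs <;> simp
    · refine Valued.v.map_sum_le fun k hk => ?_
      rw [Finset.mem_erase] at hk
      rw [Valuation.map_mul]
      by_cases hkj : j < k
      · rw [hu.1 hkj, Valuation.map_zero, mul_zero]
        exact zero_le
      · by_cases hki : k < i
        · rw [hu'.1 hki, Valuation.map_zero, zero_mul]
          exact zero_le
        · have hk' : (k : ℕ) < j := lt_of_le_of_ne (Fin.le_def.1 (not_lt.1 hkj)) (fun h => hk.1 (Fin.ext h))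
          have hik : (i : ℕ) ≤ k := Fin.le_def.1 (not_lt.1 hki)
          exact mul_le_one' (ih i k (by omega)) (hint k j)

/-! ### The group `H⁰`: integral matrices, upper unitriangular modulo `𝔭^M` -/

/-- `g` is integral and `g - 1` is strictly upper triangular modulo `𝔭^M`: the lower and diagonal
entries of `g - 1` have valuation `≤ exp(-M)`. [folklore] -/
def IsUpperModLevel (M : ℤ) (g : Matrix (Fin N) (Fin N) F) : Prop :=
  (∀ i j, 𝓋 (g i j) ≤ 1) ∧ ∀ i j, j ≤ i → 𝓋 ((g - 1) i j) ≤ exp (-M)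

namespace IsUpperModLevel

variable {M : ℤ}

/-- `1` is upper modulo every level. [folklore] -/
theorem one : IsUpperModLevel M (1 : Matrix (Fin N) (Fin N) F) := by
  refine ⟨fun i j => ?_, fun i j _ => ?_⟩
  · rw [Matrix.one_apply]
    split_ifs <;> simp
  · rw [sub_self, Matrix.zero_apply, Valuation.map_zero]
    exact zero_le

omit [Valued F ℤᵐ⁰] in
/-- Off the diagonal `(g - 1)_{ij} = g_{ij}`. [folklore] -/
theorem sub_one_apply_of_ne (g : Matrix (Fin N) (Fin N) F) {i j : Fin N} (hij : i ≠ j) :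
    (g - 1) i j = g i j := by
  rw [Matrix.sub_apply, Matrix.one_apply_ne hij, sub_zero]

/-- The entries of `g - 1` are integral. [folklore] -/
theorem sub_one_le_one {g : Matrix (Fin N) (Fin N) F} (hg : IsUpperModLevel M g) (i j : Fin N) :
    𝓋 ((g - 1) i j) ≤ 1 := by
  rw [Matrix.sub_apply]
  refine (Valuation.map_sub _ _ _).trans (max_le (hg.1 i j) ?_)
  rw [Matrix.one_apply]
  split_ifs <;> simp

/-- The strictly lower entries of `g` are `≤ exp(-M)`. [folklore] -/
theorem lower_le {g : Matrix (Fin N) (Fin N) F} (hg : IsUpperModLevel M g) {i j : Fin N} (hji : j < i) :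
    𝓋 (g i j) ≤ exp (-M) := by
  rw [← sub_one_apply_of_ne g (ne_of_gt hji)]
  exact hg.2 i j hji.le

/-- **Closure under multiplication.** [folklore] -/
theorem mul {g h : Matrix (Fin N) (Fin N) F} (hg : IsUpperModLevel M g) (hh : IsUpperModLevel M h) :
    IsUpperModLevel M (g * h) := by
  refine ⟨fun i j => ?_, fun i j hji => ?_⟩
  · simpa only [one_mul] using valued_mul_apply_le (Fin N) hg.1 hh.1 i j
  · have hgh : g * h - 1 = (g - 1) * h + (h - 1) := by
      rw [sub_mul, one_mul, sub_add_sub_cancel]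
    rw [hgh, Matrix.add_apply]
    refine Valuation.map_add_le _ ?_ (hh.2 i j hji)
    rw [Matrix.mul_apply]
    refine Valued.v.map_sum_le fun k _ => ?_
    rw [Valuation.map_mul]
    by_cases hki : k ≤ i
    · exact mul_le_of_le_of_le_one (hg.2 i k hki) (hh.1 k j)
    · have hik : i < k := not_le.1 hki
      have hkj : j ≤ k := hji.trans hik.le
      have hkj' : k ≠ j := fun h => by rw [h] at hik; exact absurd hji (not_le.2 hik)
      rw [← sub_one_apply_of_ne h hkj']
      exact mul_le_of_le_one_of_le (hg.sub_one_le_one i k) (hh.2 k j hkj)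

/-- The diagonal entries are units of valuation `1` when `M ≥ 1`. [folklore] -/
theorem valuation_diag_eq_one {g : Matrix (Fin N) (Fin N) F} (hg : IsUpperModLevel M g) (hM : 1 ≤ M)
    (i : Fin N) : 𝓋 (g i i) = 1 := by
  have h1 : g i i = 1 + (g - 1) i i := by rw [Matrix.sub_apply, Matrix.one_apply_eq, add_sub_cancel]
  rw [h1]
  refine Valuation.map_one_add_of_lt _ ((hg.2 i i le_rfl).trans_lt ?_)
  rw [← exp_zero, exp_lt_exp]
  omega

/-- The super-diagonal entries of `(g - 1)(h - 1)` are `≤ exp(-M)`. [folklore] -/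
theorem valuation_sub_one_mul_sub_one_le {g h : Matrix (Fin N) (Fin N) F} (hg : IsUpperModLevel M g)
    (hh : IsUpperModLevel M h) {i j : Fin N} (hij : (i : ℕ) + 1 = j) :
    𝓋 (((g - 1) * (h - 1)) i j) ≤ exp (-M) := by
  rw [Matrix.mul_apply]
  refine Valued.v.map_sum_le fun k _ => ?_
  rw [Valuation.map_mul]
  by_cases hki : k ≤ i
  · exact mul_le_of_le_of_le_one (hg.2 i k hki) (hh.sub_one_le_one k j)
  · have hjk : j ≤ k := Fin.le_def.2 (by have := Fin.lt_def.1 (not_le.1 hki); omega)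
    exact mul_le_of_le_one_of_le (hg.sub_one_le_one i k) (hh.2 k j hjk)

end IsUpperModLevel

variable (N) in
/-- **The group `H⁰ = N(𝒪) K(𝔭^M)`** of `g ∈ GL_N(F)` with `g` and `g⁻¹` integral and upper
unitriangular modulo `𝔭^M`. [folklore] -/
def upperModLevel (M : ℤ) : Subgroup (GL (Fin N) F) where
  carrier := {g | IsUpperModLevel M (g : Matrix (Fin N) (Fin N) F) ∧
    IsUpperModLevel M ((g⁻¹ : GL (Fin N) F) : Matrix (Fin N) (Fin N) F)}
  one_mem' := ⟨by rw [Units.val_one]; exact IsUpperModLevel.one,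
    by rw [inv_one, Units.val_one]; exact IsUpperModLevel.one⟩
  mul_mem' := by
    rintro g h ⟨hg, hg'⟩ ⟨hh, hh'⟩
    refine ⟨by rw [Units.val_mul]; exact hg.mul hh, ?_⟩
    rw [_root_.mul_inv_rev, Units.val_mul]
    exact hh'.mul hg'
  inv_mem' := by
    rintro g ⟨hg, hg'⟩
    exact ⟨hg', by rw [inv_inv]; exact hg⟩

/-- Membership in `upperModLevel`. [folklore] -/
theorem mem_upperModLevel_iff {M : ℤ} {g : GL (Fin N) F} :
    g ∈ upperModLevel N M ↔ IsUpperModLevel M (g : Matrix (Fin N) (Fin N) F) ∧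
      IsUpperModLevel M ((g⁻¹ : GL (Fin N) F) : Matrix (Fin N) (Fin N) F) := Iff.rfl

/-- **`K(𝔭^M) ≤ H⁰`** for `M ≥ 0`. [folklore] -/
theorem valuedCongruenceSubgroup_le_upperModLevel {M : ℤ} :
    valuedCongruenceSubgroup (Fin N) (exp (-M)) ≤ upperModLevel (F := F) N M := by
  intro g hg
  have hg' : g⁻¹ ∈ valuedCongruenceSubgroup (Fin N) (exp (-M)) := inv_mem hg
  exact ⟨⟨hg.1, fun i j _ => hg.2.2 i j⟩, ⟨hg'.1, fun i j _ => hg'.2.2 i j⟩⟩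

/-- **`H⁰ ≤ GL_N(𝒪)`.** [folklore] -/
theorem upperModLevel_le_valuedCongruenceSubgroup_one {M : ℤ} :
    upperModLevel (F := F) N M ≤ valuedCongruenceSubgroup (Fin N) (1 : ℤᵐ⁰) := fun _ hg =>
  ⟨hg.1.1, hg.2.1, fun i j => hg.1.sub_one_le_one i j⟩

/-- **Integral column matrices `1 + b ⊗ e_j` (with `b` supported above `j`) lie in `H⁰`.**
[folklore] -/
theorem colGL_mem_upperModLevel {M : ℤ} (b : Fin N → F) (j : Fin N) (hb : ∀ l, j ≤ l → b l = 0)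
    (hbi : ∀ l, 𝓋 (b l) ≤ 1) : colGL b j (hb j le_rfl) ∈ upperModLevel N M := by
  refine ⟨⟨fun l m => ?_, fun l m hml => ?_⟩, ⟨fun l m => ?_, fun l m hml => ?_⟩⟩
  · rw [colGL_apply]
    refine Valuation.map_add_le _ ?_ ?_
    · split_ifs <;> simp
    · split_ifs
      · exact hbi l
      · simp
  · rw [Matrix.sub_apply, colGL_apply, Matrix.one_apply, add_sub_cancel_left]
    split_ifs with hmj
    · rw [hb l (hmj ▸ hml), Valuation.map_zero]
      exact zero_le
    · rw [Valuation.map_zero]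
      exact zero_le
  · rw [colGL_inv_apply]
    refine Valuation.map_sub_le _ ?_ ?_
    · split_ifs <;> simp
    · split_ifs
      · exact hbi l
      · simp
  · rw [Matrix.sub_apply, colGL_inv_apply, Matrix.one_apply, sub_sub_cancel_left, Valuation.map_neg]
    split_ifs with hmj
    · rw [hb l (hmj ▸ hml), Valuation.map_zero]
      exact zero_le
    · rw [Valuation.map_zero]
      exact zero_le

/-! ### UL factorisation in `H⁰` -/

/-- `X` has no strictly upper entries in the columns `≥ d`. [folklore] -/
def ClearedFrom (d : ℕ) (X : Matrix (Fin N) (Fin N) F) : Prop :=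
  ∀ i j : Fin N, d ≤ (j : ℕ) → i < j → X i j = 0

/-- The inductive step and the induction of the UL factorisation. [folklore] -/
theorem exists_unipotent_mul_lower_aux {M : ℤ} (hM : 1 ≤ M) :
    ∀ (d : ℕ) (g : GL (Fin N) F), IsUpperModLevel M (g : Matrix (Fin N) (Fin N) F) →
      ClearedFrom d (g : Matrix (Fin N) (Fin N) F) →
      ∃ n : GL (Fin N) F, n ∈ upperUnitriangular (Fin N) F ∧ n ∈ upperModLevel N M ∧
        ClearedFrom 0 ((n * g : GL (Fin N) F) : Matrix (Fin N) (Fin N) F) ∧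
        IsUpperModLevel M ((n * g : GL (Fin N) F) : Matrix (Fin N) (Fin N) F)
  | 0 => fun g hg hc => ⟨1, one_mem _, one_mem _, by rwa [one_mul], by rwa [one_mul]⟩
  | d + 1 => fun g hg hc => by
    by_cases hd : d < N
    · set jd : Fin N := ⟨d, hd⟩ with hjd
      have hpiv : 𝓋 ((g : Matrix (Fin N) (Fin N) F) jd jd) = 1 := hg.valuation_diag_eq_one hM jd
      have hpiv0 : (g : Matrix (Fin N) (Fin N) F) jd jd ≠ 0 := fun h => by
        rw [h, Valuation.map_zero] at hpiv
        exact zero_ne_one hpiv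
      set b : Fin N → F := fun i => if i < jd then
        -((g : Matrix (Fin N) (Fin N) F) i jd * ((g : Matrix (Fin N) (Fin N) F) jd jd)⁻¹) else 0 with hbdef
      have hb : ∀ l, jd ≤ l → b l = 0 := fun l hl => if_neg (not_lt.2 hl)
      have hbi : ∀ l, 𝓋 (b l) ≤ 1 := by
        intro l
        simp only [hbdef]
        split_ifs
        · rw [Valuation.map_neg, Valuation.map_mul, map_inv₀, hpiv, inv_one, mul_one]
          exact hg.1 l jd
        · rw [Valuation.map_zero]
          exact zero_le
      set c : GL (Fin N) F := colGL b jd (hb jd le_rfl) with hcdef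
      have hcg : ∀ i m, ((c * g : GL (Fin N) F) : Matrix (Fin N) (Fin N) F) i m =
          (g : Matrix (Fin N) (Fin N) F) i m + b i * (g : Matrix (Fin N) (Fin N) F) jd m := by
        intro i m
        rw [Units.val_mul, Matrix.mul_apply]
        simp_rw [hcdef, colGL_apply, add_mul, Finset.sum_add_distrib, ite_mul, one_mul, zero_mul,
          Finset.sum_ite_eq, Finset.sum_ite_eq', Finset.mem_univ, if_true]
      have hc' : ClearedFrom d ((c * g : GL (Fin N) F) : Matrix (Fin N) (Fin N) F) := by
        intro i m hdm him
        rw [hcg]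
        by_cases hm : m = jd
        · subst hm
          have hi : i < jd := him
          simp only [hbdef, if_pos hi]
          rw [neg_mul, inv_mul_cancel_right₀ hpiv0, add_neg_cancel]
        · have hdm' : d + 1 ≤ (m : ℕ) := by
            have : (m : ℕ) ≠ d := fun h => hm (Fin.ext h)
            omega
          rw [hc i m hdm' him, hc jd m hdm' (Fin.lt_def.2 (by simp [hjd]; omega)), mul_zero, add_zero]
      have hcgU : IsUpperModLevel M ((c * g : GL (Fin N) F) : Matrix (Fin N) (Fin N) F) := by
        refine ⟨fun i m => ?_, fun i m hmi => ?_⟩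
        · rw [hcg]
          refine Valuation.map_add_le _ (hg.1 i m) ?_
          rw [Valuation.map_mul]
          exact mul_le_one' (hbi i) (hg.1 jd m)
        · have h1 : (((c * g : GL (Fin N) F) : Matrix (Fin N) (Fin N) F) - 1) i m =
              ((g : Matrix (Fin N) (Fin N) F) - 1) i m + b i * (g : Matrix (Fin N) (Fin N) F) jd m := by
            rw [Matrix.sub_apply, Matrix.sub_apply, hcg]
            ring
          rw [h1]
          refine Valuation.map_add_le _ (hg.2 i m hmi) ?_
          by_cases hi : i < jd
          · have hmjd : m < jd := lt_of_le_of_lt hmi hi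
            rw [Valuation.map_mul]
            exact mul_le_of_le_one_of_le (hbi i) (hg.lower_le hmjd)
          · simp only [hbdef, if_neg hi, zero_mul, Valuation.map_zero]
            exact zero_le
      obtain ⟨n', hn'N, hn'H, hcl, hup⟩ := exists_unipotent_mul_lower_aux hM d (c * g) hcgU hc'
      refine ⟨n' * c, mul_mem hn'N (colGL_mem_upperUnitriangular b jd hb),
        mul_mem hn'H (colGL_mem_upperModLevel b jd hb hbi), ?_, ?_⟩
      · rwa [mul_assoc]
      · rwa [mul_assoc]
    · refine exists_unipotent_mul_lower_aux hM d g hg fun i j hj hij => ?_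
      exact absurd (lt_of_lt_of_le j.2 ((not_lt.1 hd).trans hj)) (lt_irrefl _)

/-- **UL factorisation in `H⁰`** (`M ≥ 1`): for `g ∈ H⁰` there is an integral upper unitriangular
`n ∈ H⁰` with `n g` lower triangular (and again in `H⁰`). [folklore] -/
theorem exists_unipotent_mul_lower {M : ℤ} (hM : 1 ≤ M) {g : GL (Fin N) F} (hg : g ∈ upperModLevel N M) :
    ∃ n : GL (Fin N) F, n ∈ upperUnitriangular (Fin N) F ∧ n ∈ upperModLevel N M ∧
      (∀ i j : Fin N, i < j → ((n * g : GL (Fin N) F) : Matrix (Fin N) (Fin N) F) i j = 0) ∧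
      IsUpperModLevel M ((n * g : GL (Fin N) F) : Matrix (Fin N) (Fin N) F) := by
  obtain ⟨n, hnN, hnH, hcl, hup⟩ :=
    exists_unipotent_mul_lower_aux hM N g hg.1 fun i j hj _ => absurd j.2 (not_lt.2 hj)
  exact ⟨n, hnN, hnH, fun i j hij => hcl i j (Nat.zero_le _) hij, hup⟩

/-! ### The character `ψ(Σ h_{i,i+1})` on `d H⁰ d⁻¹` -/

/-- **`ψ` kills the super-diagonal sum of `d X d⁻¹` when the super-diagonal entries of `X` are
`≤ exp(-M)` and `ψ(t_i t_{i+1}⁻¹ 𝔭^M) = 1`.** [folklore] -/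
theorem addChar_sdiagMat_diagConj_eq_one (ψ : AddChar F Circle) {t : Fin N → Fˣ} {M : ℤ}
    (hψ : ∀ i j : Fin N, (i : ℕ) + 1 = j → ∀ x : F, 𝓋 x ≤ exp (-M) → ψ ((t i : F) * (t j : F)⁻¹ * x) = 1)
    {X : Matrix (Fin N) (Fin N) F} (hX : ∀ i j : Fin N, (i : ℕ) + 1 = j → 𝓋 (X i j) ≤ exp (-M)) :
    ψ (sdiagMat (diagConj t X)) = 1 := by
  unfold sdiagMat
  refine addChar_sum_eq_one ψ _ fun i _ => addChar_sum_eq_one ψ _ fun j _ => ?_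
  split_ifs with hij
  · rw [diagConj_apply, mul_right_comm]
    exact hψ i j hij _ (hX i j hij)
  · exact AddChar.map_zero_eq_one ψ

/-- **Multiplicativity of `g ↦ ψ(Σ (d g d⁻¹)_{i,i+1})` on `H⁰`** when `ψ(t_i t_{i+1}⁻¹ 𝔭^M) = 1`:
`g h = g + h - 1 + (g - 1)(h - 1)` and the last term has small super-diagonal. [folklore] -/
theorem addChar_sdiagMat_diagConj_mul (ψ : AddChar F Circle) {t : Fin N → Fˣ} {M : ℤ}
    (hψ : ∀ i j : Fin N, (i : ℕ) + 1 = j → ∀ x : F, 𝓋 x ≤ exp (-M) → ψ ((t i : F) * (t j : F)⁻¹ * x) = 1)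
    {g h : Matrix (Fin N) (Fin N) F} (hg : IsUpperModLevel M g) (hh : IsUpperModLevel M h) :
    ψ (sdiagMat (diagConj t (g * h))) = ψ (sdiagMat (diagConj t g)) * ψ (sdiagMat (diagConj t h)) := by
  rw [mul_eq_add_add_sub_one_mul g h, diagConj_add, diagConj_sub, diagConj_add, diagConj_one,
    sdiagMat_add, sdiagMat_sub, sdiagMat_add, sdiagMat_one, sub_zero, AddChar.map_add_eq_mul,
    AddChar.map_add_eq_mul,
    addChar_sdiagMat_diagConj_eq_one ψ hψ (fun i j hij => hg.valuation_sub_one_mul_sub_one_le hh hij),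
    mul_one]

/-! ### The spread level group `d H⁰ d⁻¹` -/

/-- **The spread level group `H_t = d H⁰ d⁻¹`**, `d = diag(t)`. [folklore] -/
def spreadLevelGroup (t : Fin N → Fˣ) (M : ℤ) : Subgroup (GL (Fin N) F) :=
  (upperModLevel N M).map (MulAut.conj (glDiagonal N F t)).toMonoidHom

/-- Membership in `H_t`: `d⁻¹ h d ∈ H⁰`. [folklore] -/
theorem mem_spreadLevelGroup_iff {t : Fin N → Fˣ} {M : ℤ} {h : GL (Fin N) F} :
    h ∈ spreadLevelGroup t M ↔ (glDiagonal N F t)⁻¹ * h * glDiagonal N F t ∈ upperModLevel N M := by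
  rw [spreadLevelGroup, Subgroup.mem_map_equiv, MulAut.conj_symm_apply]

/-- `d g d⁻¹ ∈ H_t` for `g ∈ H⁰`. [folklore] -/
theorem conj_mem_spreadLevelGroup {t : Fin N → Fˣ} {M : ℤ} {g : GL (Fin N) F} (hg : g ∈ upperModLevel N M) :
    glDiagonal N F t * g * (glDiagonal N F t)⁻¹ ∈ spreadLevelGroup t M := by
  rw [mem_spreadLevelGroup_iff]
  have : (glDiagonal N F t)⁻¹ * (glDiagonal N F t * g * (glDiagonal N F t)⁻¹) * glDiagonal N F t = g := by group
  rwa [this]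

/-- Every `h ∈ H_t` is `d g d⁻¹` with `g ∈ H⁰`. [folklore] -/
theorem exists_eq_conj_of_mem_spreadLevelGroup {t : Fin N → Fˣ} {M : ℤ} {h : GL (Fin N) F}
    (hh : h ∈ spreadLevelGroup t M) :
    ∃ g ∈ upperModLevel N M, h = glDiagonal N F t * g * (glDiagonal N F t)⁻¹ :=
  ⟨_, mem_spreadLevelGroup_iff.1 hh, by group⟩

/-- **The character `h ↦ ψ(Σ_i h_{i,i+1})` is multiplicative on `H_t`** when
`ψ(t_i t_{i+1}⁻¹ 𝔭^M) = 1`. [folklore] -/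
theorem addChar_sdiagMat_mul_of_mem_spreadLevelGroup (ψ : AddChar F Circle) {t : Fin N → Fˣ} {M : ℤ}
    (hψ : ∀ i j : Fin N, (i : ℕ) + 1 = j → ∀ x : F, 𝓋 x ≤ exp (-M) → ψ ((t i : F) * (t j : F)⁻¹ * x) = 1)
    {h₁ h₂ : GL (Fin N) F} (hh₁ : h₁ ∈ spreadLevelGroup t M) (hh₂ : h₂ ∈ spreadLevelGroup t M) :
    ψ (sdiagMat ((h₁ * h₂ : GL (Fin N) F) : Matrix (Fin N) (Fin N) F)) =
      ψ (sdiagMat (h₁ : Matrix (Fin N) (Fin N) F)) * ψ (sdiagMat (h₂ : Matrix (Fin N) (Fin N) F)) := by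
  obtain ⟨g₁, hg₁, rfl⟩ := exists_eq_conj_of_mem_spreadLevelGroup hh₁
  obtain ⟨g₂, hg₂, rfl⟩ := exists_eq_conj_of_mem_spreadLevelGroup hh₂
  have hprod : glDiagonal N F t * g₁ * (glDiagonal N F t)⁻¹ * (glDiagonal N F t * g₂ * (glDiagonal N F t)⁻¹) =
      glDiagonal N F t * (g₁ * g₂) * (glDiagonal N F t)⁻¹ := by group
  rw [hprod, coe_glDiagonal_conj, coe_glDiagonal_conj, coe_glDiagonal_conj, Units.val_mul]
  exact addChar_sdiagMat_diagConj_mul ψ hψ hg₁.1 hg₂.1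

/-- **The unipotents of the spread band lie in `H_t`**: `u ∈ N_N(F)` with `|u_{ij} t_j| ≤ |t_i|`
(the `right` family of `IsSpreadWhittaker`). [folklore] -/
theorem mem_spreadLevelGroup_of_mem_upperUnitriangular {t : Fin N → Fˣ} {M : ℤ} {u : GL (Fin N) F}
    (hu : u ∈ upperUnitriangular (Fin N) F)
    (hbd : ∀ i j, 𝓋 ((u : Matrix (Fin N) (Fin N) F) i j * t j) ≤ 𝓋 (t i : F)) :
    u ∈ spreadLevelGroup t M := by
  rw [mem_spreadLevelGroup_iff]
  set g : GL (Fin N) F := (glDiagonal N F t)⁻¹ * u * glDiagonal N F t with hgdef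
  have hcoe : (g : Matrix (Fin N) (Fin N) F) = diagConj t⁻¹ u := coe_glDiagonal_inv_conj t u
  have ht0 : ∀ i, 𝓋 (t i : F) ≠ 0 := fun i => (Valuation.ne_zero_iff _).2 (t i).ne_zero
  -- `g` is an integral upper unitriangular matrix
  have hgN : g ∈ upperUnitriangular (Fin N) F := by
    rw [mem_upperUnitriangular_iff] at hu ⊢
    refine ⟨fun i j hji => ?_, fun i => ?_⟩
    · rw [hcoe, diagConj_inv_apply, hu.1 hji, mul_zero, zero_mul]
    · rw [hcoe, diagConj_inv_apply, hu.2 i, mul_one, inv_mul_cancel₀ (t i).ne_zero]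
  have hgi : ∀ i j, 𝓋 ((g : Matrix (Fin N) (Fin N) F) i j) ≤ 1 := by
    intro i j
    rw [hcoe, diagConj_inv_apply, Valuation.map_mul, Valuation.map_mul, map_inv₀]
    have h := hbd i j
    rw [Valuation.map_mul] at h
    calc (𝓋 (t i : F))⁻¹ * 𝓋 ((u : Matrix (Fin N) (Fin N) F) i j) * 𝓋 (t j : F)
        = (𝓋 (t i : F))⁻¹ * (𝓋 ((u : Matrix (Fin N) (Fin N) F) i j) * 𝓋 (t j : F)) := by rw [mul_assoc]
      _ ≤ (𝓋 (t i : F))⁻¹ * 𝓋 (t i : F) := mul_le_mul' le_rfl h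
      _ = 1 := inv_mul_cancel₀ (ht0 i)
  have hgi' := valuation_inv_le_one_of_mem_upperUnitriangular hgN hgi
  have hgN' : g⁻¹ ∈ upperUnitriangular (Fin N) F := inv_mem hgN
  rw [mem_upperUnitriangular_iff] at hgN hgN'
  refine ⟨⟨hgi, fun i j hji => ?_⟩, ⟨hgi', fun i j hji => ?_⟩⟩
  · rcases hji.lt_or_eq with hji | hji
    · rw [IsUpperModLevel.sub_one_apply_of_ne _ (ne_of_gt hji), hgN.1 hji, Valuation.map_zero]
      exact zero_le
    · subst hji
      rw [Matrix.sub_apply, hgN.2, Matrix.one_apply_eq, sub_self, Valuation.map_zero]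
      exact zero_le
  · rcases hji.lt_or_eq with hji | hji
    · rw [IsUpperModLevel.sub_one_apply_of_ne _ (ne_of_gt hji), hgN'.1 hji, Valuation.map_zero]
      exact zero_le
    · subst hji
      rw [Matrix.sub_apply, hgN'.2, Matrix.one_apply_eq, sub_self, Valuation.map_zero]
      exact zero_le

/-- The `d`-twisted congruence condition `|(κ - 1)_{ij} t_j| ≤ exp(-M) |t_i|` says that
`d⁻¹ κ d - 1` has entries `≤ exp(-M)`. [folklore] -/
theorem valuation_diagConj_inv_sub_one_le {t : Fin N → Fˣ} {M : ℤ} {κ : GL (Fin N) F}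
    (hκ : ∀ i j, 𝓋 (((κ : Matrix (Fin N) (Fin N) F) - 1) i j * t j) ≤ exp (-M) * 𝓋 (t i : F))
    (i j : Fin N) :
    𝓋 ((diagConj t⁻¹ (κ : Matrix (Fin N) (Fin N) F) - 1) i j) ≤ exp (-M) := by
  have ht0 : ∀ i, 𝓋 (t i : F) ≠ 0 := fun i => (Valuation.ne_zero_iff _).2 (t i).ne_zero
  have h1 : (diagConj t⁻¹ (κ : Matrix (Fin N) (Fin N) F) - 1) i j =
      ((t i : F))⁻¹ * (((κ : Matrix (Fin N) (Fin N) F) - 1) i j * t j) := by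
    have e : diagConj t⁻¹ (κ : Matrix (Fin N) (Fin N) F) - 1 = diagConj t⁻¹ ((κ : Matrix (Fin N) (Fin N) F) - 1) := by
      rw [diagConj_sub, diagConj_one]
    rw [e, diagConj_inv_apply]
    ring
  rw [h1, Valuation.map_mul, map_inv₀]
  calc (𝓋 (t i : F))⁻¹ * 𝓋 (((κ : Matrix (Fin N) (Fin N) F) - 1) i j * (t j : F))
      ≤ (𝓋 (t i : F))⁻¹ * (exp (-M) * 𝓋 (t i : F)) := mul_le_mul' le_rfl (hκ i j)
    _ = exp (-M) := by rw [mul_left_comm, inv_mul_cancel₀ (ht0 i), mul_one]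

/-- **The `d`-twisted congruence elements lie in `H_t`** (`M ≥ 0`): `κ` with
`|(κ^{±1} - 1)_{ij} t_j| ≤ exp(-M) |t_i|` (the `level` family of `IsSpreadWhittaker`). [folklore] -/
theorem mem_spreadLevelGroup_of_level {t : Fin N → Fˣ} {M : ℤ} (hM : 0 ≤ M) {κ : GL (Fin N) F}
    (hκ : ∀ i j, 𝓋 (((κ : Matrix (Fin N) (Fin N) F) - 1) i j * t j) ≤ exp (-M) * 𝓋 (t i : F))
    (hκ' : ∀ i j, 𝓋 ((((κ⁻¹ : GL (Fin N) F) : Matrix (Fin N) (Fin N) F) - 1) i j * t j) ≤ exp (-M) * 𝓋 (t i : F)) :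
    κ ∈ spreadLevelGroup t M := by
  rw [mem_spreadLevelGroup_iff]
  refine valuedCongruenceSubgroup_le_upperModLevel ?_
  have hexp : exp (-M) ≤ (1 : ℤᵐ⁰) := by rw [← exp_zero, exp_le_exp]; omega
  have hcoe : (((glDiagonal N F t)⁻¹ * κ * glDiagonal N F t : GL (Fin N) F) : Matrix (Fin N) (Fin N) F) =
      diagConj t⁻¹ κ := coe_glDiagonal_inv_conj t κ
  have hcoe' : ((((glDiagonal N F t)⁻¹ * κ * glDiagonal N F t)⁻¹ : GL (Fin N) F) : Matrix (Fin N) (Fin N) F) =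
      diagConj t⁻¹ ((κ⁻¹ : GL (Fin N) F) : Matrix (Fin N) (Fin N) F) := by
    have e : ((glDiagonal N F t)⁻¹ * κ * glDiagonal N F t)⁻¹ = (glDiagonal N F t)⁻¹ * κ⁻¹ * glDiagonal N F t := by
      group
    rw [e]
    exact coe_glDiagonal_inv_conj t κ⁻¹
  have hint : ∀ (X : Matrix (Fin N) (Fin N) F), (∀ i j, 𝓋 ((X - 1) i j) ≤ exp (-M)) → ∀ i j, 𝓋 (X i j) ≤ 1 := by
    intro X hX i j
    have h : X i j = (X - 1) i j + (1 : Matrix (Fin N) (Fin N) F) i j := by rw [Matrix.sub_apply, sub_add_cancel]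
    rw [h]
    refine Valuation.map_add_le _ ((hX i j).trans hexp) ?_
    rw [Matrix.one_apply]
    split_ifs <;> simp
  have h1 := valuation_diagConj_inv_sub_one_le hκ
  have h2 := valuation_diagConj_inv_sub_one_le hκ'
  refine ⟨fun i j => ?_, fun i j => ?_, fun i j => ?_⟩
  · rw [hcoe]; exact hint _ h1 i j
  · rw [hcoe']; exact hint _ h2 i j
  · rw [hcoe]; exact h1 i j

omit [Valued F ℤᵐ⁰] in
/-- **The character is `ψ_N` on the unipotents.** [folklore] -/
theorem addChar_sdiagMat_unipotent (ψ : AddChar F Circle) (u : ↥(upperUnitriangular (Fin N) F)) :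
    (ψ (sdiagMat ((u : GL (Fin N) F) : Matrix (Fin N) (Fin N) F)) : ℂ) = whittakerCharFun ψ u := rfl

/-- **The character is trivial on the `d`-twisted congruence elements** when
`ψ(t_i t_{i+1}⁻¹ 𝔭^M) = 1`. [folklore] -/
theorem addChar_sdiagMat_eq_one_of_level (ψ : AddChar F Circle) {t : Fin N → Fˣ} {M : ℤ}
    (hψ : ∀ i j : Fin N, (i : ℕ) + 1 = j → ∀ x : F, 𝓋 x ≤ exp (-M) → ψ ((t i : F) * (t j : F)⁻¹ * x) = 1)
    {κ : GL (Fin N) F}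
    (hκ : ∀ i j, 𝓋 (((κ : Matrix (Fin N) (Fin N) F) - 1) i j * t j) ≤ exp (-M) * 𝓋 (t i : F)) :
    ψ (sdiagMat (κ : Matrix (Fin N) (Fin N) F)) = 1 := by
  have h1 : (κ : Matrix (Fin N) (Fin N) F) = diagConj t (diagConj t⁻¹ (κ : Matrix (Fin N) (Fin N) F) - 1) + 1 := by
    rw [diagConj_sub, diagConj_one, sub_add_cancel]
    ext i j
    rw [diagConj_apply, diagConj_inv_apply]
    field_simp
  rw [h1, sdiagMat_add, sdiagMat_one, add_zero]
  exact addChar_sdiagMat_diagConj_eq_one ψ hψ fun i j _ => valuation_diagConj_inv_sub_one_le hκ i j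

/-! ### Conjugation estimate and the factorisation `h = u b` -/

/-- **Conjugation estimate**: for `h ∈ H_t` and `k ∈ K(𝔭^b)`, `h⁻¹ k h ∈ K(exp(-b) R²)` where
`R` bounds the ratios `|t_i / t_j|` and `exp(-b) R² ≤ 1`. [folklore] -/
theorem conj_mem_valuedCongruenceSubgroup_of_mem_spreadLevelGroup {t : Fin N → Fˣ} {M : ℤ} {R r : ℤᵐ⁰}
    (hR : ∀ i j, 𝓋 ((t i : F) * (t j : F)⁻¹) ≤ R) (hr : r * R * R ≤ 1)
    {h : GL (Fin N) F} (hh : h ∈ spreadLevelGroup t M) {k : GL (Fin N) F}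
    (hk : k ∈ valuedCongruenceSubgroup (Fin N) r) :
    h⁻¹ * k * h ∈ valuedCongruenceSubgroup (Fin N) (r * R * R) := by
  obtain ⟨g, hg, rfl⟩ := exists_eq_conj_of_mem_spreadLevelGroup hh
  set d := glDiagonal N F t with hd
  -- entrywise bound for `d (g⁻¹ (d⁻¹ X d) g) d⁻¹` with `X` small
  have key : ∀ X : Matrix (Fin N) (Fin N) F, (∀ i j, 𝓋 (X i j) ≤ r) →
      ∀ i j, 𝓋 (diagConj t (((g⁻¹ : GL (Fin N) F) : Matrix (Fin N) (Fin N) F) * diagConj t⁻¹ X *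
        (g : Matrix (Fin N) (Fin N) F)) i j) ≤ r * R * R := by
    intro X hX
    have h1 : ∀ i j, 𝓋 (diagConj t⁻¹ X i j) ≤ r * R := by
      intro i j
      rw [diagConj_inv_apply,
        show ((t i : F))⁻¹ * X i j * (t j : F) = X i j * ((t j : F) * ((t i : F))⁻¹) by ring,
        Valuation.map_mul]
      exact mul_le_mul' (hX i j) (hR j i)
    have h2 : ∀ i j, 𝓋 ((((g⁻¹ : GL (Fin N) F) : Matrix (Fin N) (Fin N) F) * diagConj t⁻¹ X *
        (g : Matrix (Fin N) (Fin N) F)) i j) ≤ r * R := by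
      intro i j
      have := valued_mul_apply_le (Fin N) (valued_mul_apply_le (Fin N) hg.2.1 h1) hg.1.1 i j
      simpa only [one_mul, mul_one] using this
    intro i j
    rw [diagConj_apply, show (t i : F) * ((((g⁻¹ : GL (Fin N) F) : Matrix (Fin N) (Fin N) F) *
        diagConj t⁻¹ X * (g : Matrix (Fin N) (Fin N) F)) i j) * ((t j : F))⁻¹ =
      ((((g⁻¹ : GL (Fin N) F) : Matrix (Fin N) (Fin N) F) * diagConj t⁻¹ X * (g : Matrix (Fin N) (Fin N) F)) i j) *
        ((t i : F) * ((t j : F))⁻¹) by ring, Valuation.map_mul]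
    exact mul_le_mul' (h2 i j) (hR i j)
  -- the conjugate and its inverse, as matrices
  have hconj : ∀ k' : GL (Fin N) F,
      (((d * g * d⁻¹)⁻¹ * k' * (d * g * d⁻¹) : GL (Fin N) F) : Matrix (Fin N) (Fin N) F) - 1 =
        diagConj t (((g⁻¹ : GL (Fin N) F) : Matrix (Fin N) (Fin N) F) *
          diagConj t⁻¹ ((k' : Matrix (Fin N) (Fin N) F) - 1) * (g : Matrix (Fin N) (Fin N) F)) := by
    intro k'
    have e1 : (d * g * d⁻¹)⁻¹ * k' * (d * g * d⁻¹) = d * (g⁻¹ * (d⁻¹ * k' * d) * g) * d⁻¹ := by group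
    have hx : ((g⁻¹ : GL (Fin N) F) : Matrix (Fin N) (Fin N) F) * diagConj t⁻¹ ((k' : Matrix (Fin N) (Fin N) F) - 1) *
        (g : Matrix (Fin N) (Fin N) F) =
        ((g⁻¹ : GL (Fin N) F) : Matrix (Fin N) (Fin N) F) * diagConj t⁻¹ (k' : Matrix (Fin N) (Fin N) F) *
          (g : Matrix (Fin N) (Fin N) F) - 1 := by
      rw [diagConj_sub, diagConj_one, Matrix.mul_sub, Matrix.mul_one, Matrix.sub_mul, Units.inv_mul]
    rw [e1, hd, coe_glDiagonal_conj, Units.val_mul, Units.val_mul, coe_glDiagonal_inv_conj, hx, diagConj_sub,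
      diagConj_one]
  have hbound : ∀ k' : GL (Fin N) F, (∀ i j, 𝓋 (((k' : Matrix (Fin N) (Fin N) F) - 1) i j) ≤ r) →
      ∀ i j, 𝓋 (((((d * g * d⁻¹)⁻¹ * k' * (d * g * d⁻¹) : GL (Fin N) F) : Matrix (Fin N) (Fin N) F) - 1) i j) ≤
        r * R * R := fun k' hk' i j => by
    rw [hconj]
    exact key _ hk' i j
  have hint : ∀ k' : GL (Fin N) F, (∀ i j, 𝓋 (((k' : Matrix (Fin N) (Fin N) F) - 1) i j) ≤ r) →
      ∀ i j, 𝓋 ((((d * g * d⁻¹)⁻¹ * k' * (d * g * d⁻¹) : GL (Fin N) F) : Matrix (Fin N) (Fin N) F) i j) ≤ 1 := by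
    intro k' hk' i j
    have h : ((((d * g * d⁻¹)⁻¹ * k' * (d * g * d⁻¹) : GL (Fin N) F) : Matrix (Fin N) (Fin N) F) i j) =
        ((((d * g * d⁻¹)⁻¹ * k' * (d * g * d⁻¹) : GL (Fin N) F) : Matrix (Fin N) (Fin N) F) - 1) i j +
          (1 : Matrix (Fin N) (Fin N) F) i j := by
      rw [Matrix.sub_apply, sub_add_cancel]
    rw [h]
    refine Valuation.map_add_le _ ((hbound k' hk' i j).trans hr) ?_
    rw [Matrix.one_apply]
    split_ifs <;> simp
  have hk' : k⁻¹ ∈ valuedCongruenceSubgroup (Fin N) r := inv_mem hk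
  have hinv : ((d * g * d⁻¹)⁻¹ * k * (d * g * d⁻¹))⁻¹ = (d * g * d⁻¹)⁻¹ * k⁻¹ * (d * g * d⁻¹) := by group
  refine ⟨hint k hk.2.2, fun i j => ?_, hbound k hk.2.2⟩
  rw [hinv]
  exact hint k⁻¹ hk'.2.2 i j

/-- **Factorisation `h = u b`** of `h ∈ H_t` (`M ≥ 1`, `0 ≤ e ≤ M`, the ratios `|t_i/t_j|`, `j < i`,
being `≤ exp(-e)`): `u ∈ N_N(F)`, `b ∈ K(𝔭^e)`, and the character of `h` is `ψ_N(u)`: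
`ψ(Σ h_{i,i+1}) = ψ_N(u)` when `ψ(t_i t_{i+1}⁻¹ 𝔭^M) = 1`. [folklore] -/
theorem exists_unipotent_mul_congruence_of_mem_spreadLevelGroup (ψ : AddChar F Circle)
    {t : Fin N → Fˣ} {M e : ℤ} (hM : 1 ≤ M) (he : 0 ≤ e) (heM : e ≤ M)
    (hψ : ∀ i j : Fin N, (i : ℕ) + 1 = j → ∀ x : F, 𝓋 x ≤ exp (-M) → ψ ((t i : F) * (t j : F)⁻¹ * x) = 1)
    (hshrink : ∀ i j : Fin N, j < i → 𝓋 ((t i : F) * (t j : F)⁻¹) ≤ exp (-e))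
    {h : GL (Fin N) F} (hh : h ∈ spreadLevelGroup t M) :
    ∃ (u : GL (Fin N) F) (hu : u ∈ upperUnitriangular (Fin N) F) (b : GL (Fin N) F),
      b ∈ valuedCongruenceSubgroup (Fin N) (exp (-e)) ∧ h = u * b ∧
      (ψ (sdiagMat (h : Matrix (Fin N) (Fin N) F)) : ℂ) = whittakerCharFun ψ ⟨u, hu⟩ := by
  obtain ⟨g, hg, rfl⟩ := exists_eq_conj_of_mem_spreadLevelGroup hh
  obtain ⟨n, hnN, hnH, hlow, hL⟩ := exists_unipotent_mul_lower hM hg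
  set d := glDiagonal N F t with hd
  set L : GL (Fin N) F := n * g with hLdef
  have hLH : L ∈ upperModLevel N M := mul_mem hnH hg
  have heexp : exp (-M) ≤ exp (-e) := by rw [exp_le_exp]; omega
  have he1 : exp (-e) ≤ (1 : ℤᵐ⁰) := by rw [← exp_zero, exp_le_exp]; omega
  -- the unipotent factor `u = d n⁻¹ d⁻¹`
  have hn' : n⁻¹ ∈ upperUnitriangular (Fin N) F := inv_mem hnN
  have huN : d * n⁻¹ * d⁻¹ ∈ upperUnitriangular (Fin N) F := by
    have hn'' := hn'
    rw [mem_upperUnitriangular_iff] at hn'' ⊢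
    refine ⟨fun i j hji => ?_, fun i => ?_⟩
    · rw [hd, coe_glDiagonal_conj, diagConj_apply, hn''.1 hji, mul_zero, zero_mul]
    · rw [hd, coe_glDiagonal_conj, diagConj_apply, hn''.2 i, mul_one, mul_inv_cancel₀ (t i).ne_zero]
  -- the congruence factor `b = d L d⁻¹`
  have hLlow' : ∀ i j : Fin N, i < j → (((L⁻¹ : GL (Fin N) F) : Matrix (Fin N) (Fin N) F)) i j = 0 := by
    have hbt : (L : Matrix (Fin N) (Fin N) F).BlockTriangular (OrderDual.toDual : Fin N → (Fin N)ᵒᵈ) :=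
      fun i j hij => hlow i j hij
    haveI : Invertible (L : Matrix (Fin N) (Fin N) F) := L.invertible
    have hinv := Matrix.blockTriangular_inv_of_blockTriangular hbt
    intro i j hij
    have h := hinv hij
    rwa [Matrix.coe_units_inv]
  have hbK : d * L * d⁻¹ ∈ valuedCongruenceSubgroup (Fin N) (exp (-e)) := by
    have hent : ∀ (X : Matrix (Fin N) (Fin N) F), IsUpperModLevel M X → (∀ i j : Fin N, i < j → X i j = 0) →
        ∀ i j, 𝓋 ((diagConj t X - 1) i j) ≤ exp (-e) := by
      intro X hX hXlow i j
      rw [← diagConj_one t, ← diagConj_sub, diagConj_apply]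
      rcases lt_trichotomy i j with hij | rfl | hji
      · rw [IsUpperModLevel.sub_one_apply_of_ne X (ne_of_lt hij), hXlow i j hij, mul_zero, zero_mul,
          Valuation.map_zero]
        exact zero_le
      · rw [mul_right_comm, mul_inv_cancel₀ (t i).ne_zero, one_mul]
        exact (hX.2 i i le_rfl).trans heexp
      · rw [mul_right_comm, Valuation.map_mul]
        exact mul_le_of_le_of_le_one (hshrink i j hji) (hX.sub_one_le_one i j)
    have hint : ∀ (X : Matrix (Fin N) (Fin N) F), (∀ i j, 𝓋 ((diagConj t X - 1) i j) ≤ exp (-e)) →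
        ∀ i j, 𝓋 (diagConj t X i j) ≤ 1 := by
      intro X hX i j
      have h : diagConj t X i j = (diagConj t X - 1) i j + (1 : Matrix (Fin N) (Fin N) F) i j := by
        rw [Matrix.sub_apply, sub_add_cancel]
      rw [h]
      refine Valuation.map_add_le _ ((hX i j).trans he1) ?_
      rw [Matrix.one_apply]
      split_ifs <;> simp
    have h1 := hent _ hLH.1 hlow
    have h2 := hent _ hLH.2 hLlow'
    have hinvL : (d * L * d⁻¹)⁻¹ = d * L⁻¹ * d⁻¹ := by group
    refine ⟨fun i j => ?_, fun i j => ?_, fun i j => ?_⟩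
    · rw [hd, coe_glDiagonal_conj]; exact hint _ h1 i j
    · rw [hinvL, hd, coe_glDiagonal_conj]; exact hint _ h2 i j
    · rw [hd, coe_glDiagonal_conj]; exact h1 i j
  refine ⟨d * n⁻¹ * d⁻¹, huN, d * L * d⁻¹, hbK, by rw [hLdef]; group, ?_⟩
  -- the character: `g = n⁻¹ L = n⁻¹ + L - 1 + (n⁻¹ - 1)(L - 1)`
  rw [← addChar_sdiagMat_unipotent ψ ⟨d * n⁻¹ * d⁻¹, huN⟩]
  change (ψ (sdiagMat ((d * g * d⁻¹ : GL (Fin N) F) : Matrix (Fin N) (Fin N) F)) : ℂ) =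
    ψ (sdiagMat ((d * n⁻¹ * d⁻¹ : GL (Fin N) F) : Matrix (Fin N) (Fin N) F))
  congr 1
  have hg' : g = n⁻¹ * L := by rw [hLdef, inv_mul_cancel_left]
  rw [hg', hd, coe_glDiagonal_conj, coe_glDiagonal_conj, Units.val_mul, mul_eq_add_add_sub_one_mul,
    diagConj_add, diagConj_sub, diagConj_add, diagConj_one, sdiagMat_add, sdiagMat_sub, sdiagMat_add,
    sdiagMat_one, sub_zero, AddChar.map_add_eq_mul, AddChar.map_add_eq_mul]
  have hLsd : sdiagMat (diagConj t (L : Matrix (Fin N) (Fin N) F)) = 0 := by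
    unfold sdiagMat
    refine Finset.sum_eq_zero fun i _ => Finset.sum_eq_zero fun j _ => ?_
    split_ifs with hij
    · rw [diagConj_apply, hlow i j (Fin.lt_def.2 (by omega)), mul_zero, zero_mul]
    · rfl
  rw [hLsd, AddChar.map_zero_eq_one, mul_one,
    addChar_sdiagMat_diagConj_eq_one ψ hψ (fun i j hij => hnH.2.valuation_sub_one_mul_sub_one_le hLH.1 hij),
    mul_one]

/-- **Conjugating a congruence element by `d⁻¹`**: `d⁻¹ k d ∈ K(r R)` for `k ∈ K(r)`, `R` a bound for
the ratios `|t_i/t_j|` with `r R ≤ 1`. [folklore] -/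
theorem glDiagonal_inv_conj_mem_valuedCongruenceSubgroup {t : Fin N → Fˣ} {R r : ℤᵐ⁰}
    (hR : ∀ i j, 𝓋 ((t i : F) * (t j : F)⁻¹) ≤ R) (hr : r * R ≤ 1)
    {k : GL (Fin N) F} (hk : k ∈ valuedCongruenceSubgroup (Fin N) r) :
    (glDiagonal N F t)⁻¹ * k * glDiagonal N F t ∈ valuedCongruenceSubgroup (Fin N) (r * R) := by
  have key : ∀ X : Matrix (Fin N) (Fin N) F, (∀ i j, 𝓋 ((X - 1) i j) ≤ r) →
      ∀ i j, 𝓋 ((diagConj t⁻¹ X - 1) i j) ≤ r * R := by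
    intro X hX i j
    rw [← diagConj_one t⁻¹, ← diagConj_sub, diagConj_inv_apply,
      show ((t i : F))⁻¹ * (X - 1) i j * (t j : F) = (X - 1) i j * ((t j : F) * ((t i : F))⁻¹) by ring,
      Valuation.map_mul]
    exact mul_le_mul' (hX i j) (hR j i)
  have hint : ∀ X : Matrix (Fin N) (Fin N) F, (∀ i j, 𝓋 ((diagConj t⁻¹ X - 1) i j) ≤ r * R) →
      ∀ i j, 𝓋 (diagConj t⁻¹ X i j) ≤ 1 := by
    intro X hX i j
    have h : diagConj t⁻¹ X i j = (diagConj t⁻¹ X - 1) i j + (1 : Matrix (Fin N) (Fin N) F) i j := by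
      rw [Matrix.sub_apply, sub_add_cancel]
    rw [h]
    refine Valuation.map_add_le _ ((hX i j).trans hr) ?_
    rw [Matrix.one_apply]
    split_ifs <;> simp
  have hk' : k⁻¹ ∈ valuedCongruenceSubgroup (Fin N) r := inv_mem hk
  have e : ((glDiagonal N F t)⁻¹ * k * glDiagonal N F t)⁻¹ = (glDiagonal N F t)⁻¹ * k⁻¹ * glDiagonal N F t := by
    group
  refine ⟨fun i j => ?_, fun i j => ?_, fun i j => ?_⟩
  · rw [coe_glDiagonal_inv_conj]; exact hint _ (key _ hk.2.2) i j
  · rw [e, coe_glDiagonal_inv_conj]; exact hint _ (key _ hk'.2.2) i j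
  · rw [coe_glDiagonal_inv_conj]; exact key _ hk.2.2 i j

/-- **The character is trivial on deep congruence elements**: `ψ(Σ k_{i,i+1}) = 1` for `k ∈ K(r)` if
`ψ` kills `{|x| ≤ r}`. [folklore] -/
theorem addChar_sdiagMat_eq_one_of_mem_valuedCongruenceSubgroup (ψ : AddChar F Circle) {r : ℤᵐ⁰}
    (hψr : ∀ x : F, 𝓋 x ≤ r → ψ x = 1) {k : GL (Fin N) F} (hk : k ∈ valuedCongruenceSubgroup (Fin N) r) :
    ψ (sdiagMat (k : Matrix (Fin N) (Fin N) F)) = 1 := by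
  unfold sdiagMat
  refine addChar_sum_eq_one ψ _ fun i _ => addChar_sum_eq_one ψ _ fun j _ => ?_
  split_ifs with hij
  · refine hψr _ ?_
    have hne : i ≠ j := fun h => by rw [h] at hij; omega
    rw [← IsUpperModLevel.sub_one_apply_of_ne (k : Matrix (Fin N) (Fin N) F) hne]
    exact hk.2.2 i j
  · exact AddChar.map_zero_eq_one ψ

end Valued

end WhittakerSupport

end Literature.NumberTheory.Automorphic
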